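import Summits.CriticalPhenomena.PercolationContinuityZ3.Theorems.PercNearOneGluingNoHeavyLowerTailCILStarTransferTools
import HarnessLib

/-!
# `NoHeavyLowerTail` (stmt-CriticalPhenomena-4575) — the star of an observer SET: gates, and the flat expansion
# of set-champion stability over the boundary configuration

Support file (prover `prim-gen-induct`, blob-quotient / cumulative-isolation line, gen 3; `--supports
stmt-CriticalPhenomena-4575`).  No definitions, no named facts, no sorries.

Notation: `μ = prodBernoulli w` on `Fin n`, relays `A`, level `j`, a vertex set `S` (the observer set of
set-champion stability `CS_w(S, c) : μ(c ↮ S, 1 ≤ |π(S)| ≤ j) ≤ μ(c ↮ S, |π(c)| ≤ j)`, cf. `…CILEdgeRaising`,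
`…CILInductionStep`).  The configuration OFF `S` is `ξ(ω) = ω ∩ {e | ∀ v ∈ S, v ∉ e}` (all edges meeting `S` removed;
"the graph `K = H − S`" of the crux notes BLOBQUOTIENT.md §18–§20), and `~'` denotes reachability in `ξ(ω)`.  A GATE of
`ω` is a vertex `u ∉ S` carrying an open edge into `S`; the gate set `Γ(ω) = {u ∉ S | ∃ v ∈ S, s(u,v) ∈ ω}` is read off
the edges meeting `S`, the `~'`-events off them, and the two are independent.

* `SetStar.reachable_off_of_forall_not` — if `c ↮ S` then the cluster of `c` is its `ξ`-cluster;
* `SetStar.exists_gate_of_reachable` — a vertex outside `S` joined to `S` is `~'`-joined to a gate;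
* `SetStar.forall_not_reach_iff_gate`, `SetStar.exists_reach_iff_gate` — `c ↮ S ⇔ c ≁' Γ(ω)` and
  `π(S) = π'(Γ(ω))` (relays `~'`-joined to a gate);
* `SetStar.setL_inter_gateEq`, `SetStar.setR_inter_gateEq` — on `{Γ = Y}` the two events of `CS_w(S, c)` are the two events
  of `CS_K(Y, c)` read off `ξ`;
* `SetStar.measureReal_gateEq_inter_off` — independence of `{Γ = Y}` from the `ξ`-events;
* `SetStar.measureReal_eq_sum_gateEq` — partition of any event by the value of `Γ` over a finite family carrying it a.s.;
* `SetStar.setL_eq_sum`, `SetStar.setR_eq_sum` — **the flat expansion**: `μ(c ↮ S, 1 ≤ |π(S)| ≤ j) = Σ_Y μ{Γ = Y}·μ(c ≁' Y, 1 ≤ |π'(Y)| ≤ j)`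
  and `μ(c ↮ S, |π(c)| ≤ j) = Σ_Y μ{Γ = Y}·μ(c ≁' Y, |π'(c)| ≤ j)` — edge raising (`setCS_of_subgraph`) with ALL pairs at `S`
  raised at once, as an identity (crux notes §18, `Λ_H(S,c) = Σ_{Y'} P(Y')·Λ_K(Y',c)`).

Used by `…CILTwoGate` (the non-adjacent induction step for an observer set with at most two gates).
-/

noncomputable section

namespace Summit.CriticalPhenomena.PercolationContinuityZ3.Theorems

open MeasureTheory Set Literature.Probability.LatticeModels Literature.Probability.Percolation
open scoped Classical BigOperators

variable {n : ℕ}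

namespace CutObserver

namespace SetStar

/-! ### Reachability off an observer set -/

/-- If `c` is joined to no vertex of `S`, every vertex joined to `c` is joined to it off `S` (in `ξ(ω)`). [folklore] -/
theorem reachable_off_of_forall_not {ω : BondConfig (Fin n)} {S : Finset (Fin n)} {c a : Fin n}
    (hc : ∀ v ∈ S, ¬ (openGraph ω).Reachable c v) (hca : (openGraph ω).Reachable c a) :
    (openGraph (ω ∩ {e | ∀ v ∈ S, v ∉ e})).Reachable c a := by
  have hcl : ∀ u ∈ {v | (openGraph ω).Reachable c v}, ∀ v, s(u, v) ∈ ω → u ≠ v →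
      v ∈ {v | (openGraph ω).Reachable c v} := by
    intro u hu v huv hne
    have : (openGraph ω).Adj u v := by rw [openGraph_adj]; exact ⟨huv, hne⟩
    exact (show (openGraph ω).Reachable c u from hu).trans this.reachable
  have h := reachable_restrict_of_closed ω {v | (openGraph ω).Reachable c v} hcl
    (show (openGraph ω).Reachable c c from SimpleGraph.Reachable.refl _) hca
  have hsub : ω ∩ {e | ∀ z ∈ e, z ∈ {v | (openGraph ω).Reachable c v}} ⊆ ω ∩ {e | ∀ v ∈ S, v ∉ e} := by
    intro e he
    refine ⟨he.1, ?_⟩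
    intro v hvS hve
    exact hc v hvS (he.2 v hve)
  exact reachable_mono hsub h

/-- Walk form of the gate lemma: along an open walk from a vertex outside `S` to a vertex of `S`, the last vertex
before the first entrance into `S` is a gate `~'`-joined to the start. [folklore] -/
theorem exists_gate_of_walk {ω : BondConfig (Fin n)} {S : Finset (Fin n)} {a : Fin n} :
    ∀ {x t : Fin n} (_ : (openGraph ω).Walk x t), x ∉ S → t ∈ S →
      (openGraph (ω ∩ {e | ∀ v ∈ S, v ∉ e})).Reachable a x →
      ∃ u, u ∉ S ∧ (∃ v ∈ S, s(u, v) ∈ ω) ∧ (openGraph (ω ∩ {e | ∀ v ∈ S, v ∉ e})).Reachable a u := by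
  intro x t q
  induction q with
  | nil => intro hx ht _; exact absurd ht hx
  | @cons x b t' hadj q ih =>
    intro hx ht hax
    have hadj' := hadj
    rw [openGraph_adj] at hadj'
    by_cases hb : b ∈ S
    · exact ⟨x, hx, ⟨b, hb, hadj'.1⟩, hax⟩
    · have hstep : (openGraph (ω ∩ {e | ∀ v ∈ S, v ∉ e})).Adj x b := by
        rw [openGraph_adj]
        refine ⟨⟨hadj'.1, ?_⟩, hadj'.2⟩
        intro v hvS hve
        rcases Sym2.mem_iff.1 hve with rfl | rfl
        · exact hx hvS
        · exact hb hvS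
      exact ih hb ht (hax.trans hstep.reachable)

/-- **Gate lemma.**  A vertex `a ∉ S` joined to a vertex of `S` is `~'`-joined to a gate. [folklore] -/
theorem exists_gate_of_reachable {ω : BondConfig (Fin n)} {S : Finset (Fin n)} {a v : Fin n}
    (ha : a ∉ S) (hv : v ∈ S) (hav : (openGraph ω).Reachable a v) :
    ∃ u, u ∉ S ∧ (∃ v ∈ S, s(u, v) ∈ ω) ∧ (openGraph (ω ∩ {e | ∀ v ∈ S, v ∉ e})).Reachable a u := by
  obtain ⟨p⟩ := hav
  exact exists_gate_of_walk p ha hv (SimpleGraph.Reachable.refl _)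

/-- A gate is joined (in `ω`) to the vertex of `S` it carries an edge to. [folklore] -/
theorem reachable_of_gate {ω : BondConfig (Fin n)} {S : Finset (Fin n)} {u v : Fin n}
    (hu : u ∉ S) (hv : v ∈ S) (huv : s(u, v) ∈ ω) : (openGraph ω).Reachable v u := by
  have hne : v ≠ u := fun h => hu (h ▸ hv)
  have hadj : (openGraph ω).Adj v u := by
    rw [openGraph_adj, Sym2.eq_swap]; exact ⟨huv, hne⟩
  exact hadj.reachable

/-- **`c ↮ S` iff `c` is `~'`-joined to no gate** (`c ∉ S`). [folklore] -/
theorem forall_not_reach_iff_gate {ω : BondConfig (Fin n)} {S : Finset (Fin n)} {c : Fin n} (hc : c ∉ S) :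
    (∀ x ∈ S, ω ∉ openConn c x) ↔
      ∀ u ∈ (Finset.univ.filter fun u => u ∉ S ∧ ∃ v ∈ S, s(u, v) ∈ ω),
        ¬ (openGraph (ω ∩ {e | ∀ v ∈ S, v ∉ e})).Reachable c u := by
  constructor
  · intro h u hu hcu
    obtain ⟨-, huS, v, hvS, huv⟩ := Finset.mem_filter.1 hu
    exact h v hvS ((reachable_mono inter_subset_left hcu).trans (reachable_of_gate huS hvS huv).symm)
  · intro h x hxS hcx
    obtain ⟨u, huS, hedge, hcu⟩ := exists_gate_of_reachable hc hxS hcx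
    exact h u (Finset.mem_filter.2 ⟨Finset.mem_univ _, huS, hedge⟩) hcu

/-- **`π(S) = π'(Γ)`**: a vertex `z ∉ S` is joined to some vertex of `S` iff it is `~'`-joined to a gate. [folklore] -/
theorem exists_reach_iff_gate {ω : BondConfig (Fin n)} {S : Finset (Fin n)} {z : Fin n} (hz : z ∉ S) :
    (∃ x ∈ S, ω ∈ openConn x z) ↔
      ∃ u ∈ (Finset.univ.filter fun u => u ∉ S ∧ ∃ v ∈ S, s(u, v) ∈ ω),
        (openGraph (ω ∩ {e | ∀ v ∈ S, v ∉ e})).Reachable u z := by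
  constructor
  · rintro ⟨x, hxS, hxz⟩
    obtain ⟨u, huS, hedge, hzu⟩ :=
      exists_gate_of_reachable hz hxS (SimpleGraph.Reachable.symm (show (openGraph ω).Reachable x z from hxz))
    exact ⟨u, Finset.mem_filter.2 ⟨Finset.mem_univ _, huS, hedge⟩, hzu.symm⟩
  · rintro ⟨u, hu, huz⟩
    obtain ⟨-, huS, v, hvS, huv⟩ := Finset.mem_filter.1 hu
    exact ⟨v, hvS, (reachable_of_gate huS hvS huv).trans (reachable_mono inter_subset_left huz)⟩

/-! ### The two events of `CS_w(S, c)` on a gate class `{Γ = Y}` -/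

/-- On `{Γ = Y}`: the left event of `CS_w(S, c)` is the left event of `CS_K(Y, c)` read off `ξ(ω)`
(`S ∩ A = ∅`, `c ∉ S`). [folklore] -/
theorem setL_inter_gateEq (A S Y : Finset (Fin n)) (c : Fin n) (j : ℕ) (hSA : Disjoint S A) (hc : c ∉ S) :
    {ω : BondConfig (Fin n) | (∀ x ∈ S, ω ∉ openConn c x) ∧
        1 ≤ (A.filter fun z => ∃ x ∈ S, ω ∈ openConn x z).card ∧
        (A.filter fun z => ∃ x ∈ S, ω ∈ openConn x z).card ≤ j} ∩
      {ω | (Finset.univ.filter fun u => u ∉ S ∧ ∃ v ∈ S, s(u, v) ∈ ω) = Y} =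
    {ω | (Finset.univ.filter fun u => u ∉ S ∧ ∃ v ∈ S, s(u, v) ∈ ω) = Y} ∩
      {ω | (∀ u ∈ Y, ¬ (openGraph (ω ∩ {e | ∀ v ∈ S, v ∉ e})).Reachable c u) ∧
        1 ≤ (A.filter fun z => ∃ u ∈ Y, (openGraph (ω ∩ {e | ∀ v ∈ S, v ∉ e})).Reachable u z).card ∧
        (A.filter fun z => ∃ u ∈ Y, (openGraph (ω ∩ {e | ∀ v ∈ S, v ∉ e})).Reachable u z).card ≤ j} := by
  ext ω
  simp only [mem_inter_iff, mem_setOf_eq]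
  constructor
  · rintro ⟨⟨hsep, h1, h2⟩, hY⟩
    have hfilt : (A.filter fun z => ∃ x ∈ S, ω ∈ openConn x z) =
        (A.filter fun z => ∃ u ∈ Y, (openGraph (ω ∩ {e | ∀ v ∈ S, v ∉ e})).Reachable u z) := by
      refine Finset.filter_congr fun z hz => ?_
      rw [exists_reach_iff_gate (fun h => Finset.disjoint_left.1 hSA h hz), hY]
    refine ⟨hY, ?_, ?_, ?_⟩
    · rw [← hY]; exact (forall_not_reach_iff_gate hc).1 hsep
    · rw [← hfilt]; exact h1
    · rw [← hfilt]; exact h2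
  · rintro ⟨hY, hsep, h1, h2⟩
    have hfilt : (A.filter fun z => ∃ x ∈ S, ω ∈ openConn x z) =
        (A.filter fun z => ∃ u ∈ Y, (openGraph (ω ∩ {e | ∀ v ∈ S, v ∉ e})).Reachable u z) := by
      refine Finset.filter_congr fun z hz => ?_
      rw [exists_reach_iff_gate (fun h => Finset.disjoint_left.1 hSA h hz), hY]
    refine ⟨⟨?_, ?_, ?_⟩, hY⟩
    · rw [forall_not_reach_iff_gate hc, hY]; exact hsep
    · rw [hfilt]; exact h1
    · rw [hfilt]; exact h2

/-- On `{Γ = Y}`: the right event of `CS_w(S, c)` is the right event of `CS_K(Y, c)` read off `ξ(ω)` (`c ∉ S`). [folklore] -/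
theorem setR_inter_gateEq (A S Y : Finset (Fin n)) (c : Fin n) (j : ℕ) (hc : c ∉ S) :
    {ω : BondConfig (Fin n) | (∀ x ∈ S, ω ∉ openConn c x) ∧ (A.filter fun z => ω ∈ openConn c z).card ≤ j} ∩
      {ω | (Finset.univ.filter fun u => u ∉ S ∧ ∃ v ∈ S, s(u, v) ∈ ω) = Y} =
    {ω | (Finset.univ.filter fun u => u ∉ S ∧ ∃ v ∈ S, s(u, v) ∈ ω) = Y} ∩
      {ω | (∀ u ∈ Y, ¬ (openGraph (ω ∩ {e | ∀ v ∈ S, v ∉ e})).Reachable c u) ∧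
        (A.filter fun z => (openGraph (ω ∩ {e | ∀ v ∈ S, v ∉ e})).Reachable c z).card ≤ j} := by
  ext ω
  simp only [mem_inter_iff, mem_setOf_eq]
  constructor
  · rintro ⟨⟨hsep, h2⟩, hY⟩
    have hfilt : (A.filter fun z => ω ∈ openConn c z) =
        (A.filter fun z => (openGraph (ω ∩ {e | ∀ v ∈ S, v ∉ e})).Reachable c z) :=
      Finset.filter_congr fun z _ =>
        ⟨fun h => reachable_off_of_forall_not hsep h, fun h => reachable_mono inter_subset_left h⟩
    refine ⟨hY, ?_, ?_⟩
    · rw [← hY]; exact (forall_not_reach_iff_gate hc).1 hsep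
    · rw [← hfilt]; exact h2
  · rintro ⟨hY, hsep, h2⟩
    have hsep' : ∀ x ∈ S, ω ∉ openConn c x := by
      rw [forall_not_reach_iff_gate hc, hY]; exact hsep
    have hfilt : (A.filter fun z => ω ∈ openConn c z) =
        (A.filter fun z => (openGraph (ω ∩ {e | ∀ v ∈ S, v ∉ e})).Reachable c z) :=
      Finset.filter_congr fun z _ =>
        ⟨fun h => reachable_off_of_forall_not hsep' h, fun h => reachable_mono inter_subset_left h⟩
    refine ⟨⟨hsep', ?_⟩, hY⟩
    rw [hfilt]; exact h2

/-! ### Independence of the gate class from the configuration off `S` -/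

/-- The edges meeting `S` and the edges avoiding `S`, as coerced finsets. [folklore] -/
theorem coe_edgesMeeting (S : Finset (Fin n)) :
    (↑(Finset.univ.filter fun e : Sym2 (Fin n) => ∃ v ∈ S, v ∈ e) : Set (Sym2 (Fin n))) = {e | ∃ v ∈ S, v ∈ e} := by
  ext e; simp

/-- The edges avoiding `S`, as a coerced finset. [folklore] -/
theorem coe_edgesOff (S : Finset (Fin n)) :
    (↑(Finset.univ.filter fun e : Sym2 (Fin n) => ∀ v ∈ S, v ∉ e) : Set (Sym2 (Fin n))) = {e | ∀ v ∈ S, v ∉ e} := by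
  ext e; simp

/-- The gate class `{Γ = Y}` is determined by the edges meeting `S`. [folklore] -/
theorem determinedBy_gateEq (S Y : Finset (Fin n)) :
    DeterminedBy {ω : BondConfig (Fin n) | (Finset.univ.filter fun u => u ∉ S ∧ ∃ v ∈ S, s(u, v) ∈ ω) = Y}
      (↑(Finset.univ.filter fun e : Sym2 (Fin n) => ∃ v ∈ S, v ∈ e) : Set (Sym2 (Fin n))) := by
  rw [coe_edgesMeeting, determinedBy_iff]
  intro ω ω' hωω'
  simp only [mem_setOf_eq]
  have key : ∀ u v, v ∈ S → (s(u, v) ∈ ω ↔ s(u, v) ∈ ω') := by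
    intro u v hv
    have hmem : s(u, v) ∈ {e : Sym2 (Fin n) | ∃ v ∈ S, v ∈ e} := ⟨v, hv, Sym2.mem_mk_right u v⟩
    have := Set.ext_iff.1 hωω' s(u, v)
    simp only [mem_inter_iff, hmem, and_true] at this
    exact this
  have hΓ : (Finset.univ.filter fun u => u ∉ S ∧ ∃ v ∈ S, s(u, v) ∈ ω) =
      (Finset.univ.filter fun u => u ∉ S ∧ ∃ v ∈ S, s(u, v) ∈ ω') := by
    refine Finset.filter_congr fun u _ => ?_
    exact and_congr Iff.rfl (exists_congr fun v => and_congr_right fun hv => key u v hv)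
  rw [hΓ]

/-- An event read off `ξ(ω) = ω ∩ {e | ∀ v ∈ S, v ∉ e}` is determined by the edges avoiding `S`. [folklore] -/
theorem determinedBy_off (S : Finset (Fin n)) (P : BondConfig (Fin n) → Prop) :
    DeterminedBy {ω : BondConfig (Fin n) | P (ω ∩ {e | ∀ v ∈ S, v ∉ e})}
      (↑(Finset.univ.filter fun e : Sym2 (Fin n) => ∀ v ∈ S, v ∉ e) : Set (Sym2 (Fin n))) := by
  have h := determinedBy_restrict (Finset.univ.filter fun e : Sym2 (Fin n) => ∀ v ∈ S, v ∉ e) P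
  rw [coe_edgesOff] at h ⊢
  exact h

/-- **Independence of the gate class from the configuration off `S`**:
`μ({Γ = Y} ∩ {ω | P (ξ ω)}) = μ{Γ = Y} · μ{ω | P (ξ ω)}`. [folklore] -/
theorem measureReal_gateEq_inter_off (w : Sym2 (Fin n) → unitInterval) (S Y : Finset (Fin n))
    (P : BondConfig (Fin n) → Prop) :
    (prodBernoulli w).real
        ({ω : BondConfig (Fin n) | (Finset.univ.filter fun u => u ∉ S ∧ ∃ v ∈ S, s(u, v) ∈ ω) = Y} ∩
          {ω | P (ω ∩ {e | ∀ v ∈ S, v ∉ e})}) =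
      (prodBernoulli w).real
          {ω : BondConfig (Fin n) | (Finset.univ.filter fun u => u ∉ S ∧ ∃ v ∈ S, s(u, v) ∈ ω) = Y} *
        (prodBernoulli w).real {ω : BondConfig (Fin n) | P (ω ∩ {e | ∀ v ∈ S, v ∉ e})} := by
  have hdisj : Disjoint (Finset.univ.filter fun e : Sym2 (Fin n) => ∃ v ∈ S, v ∈ e)
      (Finset.univ.filter fun e : Sym2 (Fin n) => ∀ v ∈ S, v ∉ e) := by
    rw [Finset.disjoint_left]
    intro e he he'
    obtain ⟨-, v, hv, hve⟩ := Finset.mem_filter.1 he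
    exact (Finset.mem_filter.1 he').2 v hv hve
  exact prodBernoulli_real_inter_of_determinedBy_disjoint w hdisj (determinedBy_gateEq S Y) (determinedBy_off S P)
    MeasurableSet.of_discrete MeasurableSet.of_discrete

/-! ### Partition by the gate class, and the flat expansion -/

/-- **Partition by the value of the gate set.**  If `Γ(ω)` lies in the finite family `𝒴` almost surely, then for
every event `E`: `μ(E) = Σ_{Y ∈ 𝒴} μ(E ∩ {Γ = Y})`. [folklore] -/
theorem measureReal_eq_sum_gateEq (w : Sym2 (Fin n) → unitInterval) (S : Finset (Fin n))
    (𝒴 : Finset (Finset (Fin n)))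
    (h𝒴 : (prodBernoulli w).real
      {ω : BondConfig (Fin n) | (Finset.univ.filter fun u => u ∉ S ∧ ∃ v ∈ S, s(u, v) ∈ ω) ∉ 𝒴} = 0)
    (E : Set (BondConfig (Fin n))) :
    (prodBernoulli w).real E =
      ∑ Y ∈ 𝒴, (prodBernoulli w).real
        (E ∩ {ω | (Finset.univ.filter fun u => u ∉ S ∧ ∃ v ∈ S, s(u, v) ∈ ω) = Y}) := by
  haveI : IsProbabilityMeasure (prodBernoulli w) := inferInstance
  set μ := prodBernoulli w with hμ
  set Γ : BondConfig (Fin n) → Finset (Fin n) :=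
    fun ω => Finset.univ.filter fun u => u ∉ S ∧ ∃ v ∈ S, s(u, v) ∈ ω with hΓ
  set Z := {ω : BondConfig (Fin n) | Γ ω ∈ 𝒴} with hZ
  have hdisj : (↑𝒴 : Set (Finset (Fin n))).PairwiseDisjoint fun Y => E ∩ {ω | Γ ω = Y} := by
    intro Y _ Y' _ hne
    rw [Function.onFun, Set.disjoint_left]
    rintro ω ⟨-, hY⟩ ⟨-, hY'⟩
    exact hne (hY.symm.trans hY')
  have hunion : (⋃ Y ∈ 𝒴, (E ∩ {ω | Γ ω = Y})) = E ∩ Z := by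
    ext ω
    simp only [mem_iUnion, mem_inter_iff, mem_setOf_eq, exists_prop, hZ]
    constructor
    · rintro ⟨Y, hY, hE, hΓY⟩; exact ⟨hE, hΓY ▸ hY⟩
    · rintro ⟨hE, hω⟩; exact ⟨Γ ω, hω, hE, rfl⟩
  have hsum : ∑ Y ∈ 𝒴, μ.real (E ∩ {ω | Γ ω = Y}) = μ.real (E ∩ Z) := by
    rw [← hunion]
    exact (measureReal_biUnion_finset hdisj fun Y _ => MeasurableSet.of_discrete).symm
  have hsplit := measureReal_inter_add_sdiff (μ := μ) (s := E) (MeasurableSet.of_discrete (s := Z))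
    (measure_ne_top _ _)
  have hzero : μ.real (E \ Z) = 0 := by
    refine le_antisymm (le_trans (measureReal_mono (fun ω hω => ?_) (measure_ne_top _ _)) (le_of_eq h𝒴))
      measureReal_nonneg
    exact hω.2
  rw [hsum, ← hsplit, hzero, add_zero]

/-- **Flat expansion, left event.**  `μ(c ↮ S, 1 ≤ |π(S)| ≤ j) = Σ_{Y ∈ 𝒴} μ{Γ = Y} · μ(c ≁' Y, 1 ≤ |π'(Y)| ≤ j)`
whenever the gate set lies in `𝒴` a.s. (`S ∩ A = ∅`, `c ∉ S`). [folklore] -/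
theorem setL_eq_sum (w : Sym2 (Fin n) → unitInterval) (A S : Finset (Fin n)) (c : Fin n) (j : ℕ)
    (hSA : Disjoint S A) (hc : c ∉ S) (𝒴 : Finset (Finset (Fin n)))
    (h𝒴 : (prodBernoulli w).real
      {ω : BondConfig (Fin n) | (Finset.univ.filter fun u => u ∉ S ∧ ∃ v ∈ S, s(u, v) ∈ ω) ∉ 𝒴} = 0) :
    (prodBernoulli w).real {ω : BondConfig (Fin n) | (∀ x ∈ S, ω ∉ openConn c x) ∧
        1 ≤ (A.filter fun z => ∃ x ∈ S, ω ∈ openConn x z).card ∧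
        (A.filter fun z => ∃ x ∈ S, ω ∈ openConn x z).card ≤ j} =
      ∑ Y ∈ 𝒴,
        (prodBernoulli w).real
            {ω : BondConfig (Fin n) | (Finset.univ.filter fun u => u ∉ S ∧ ∃ v ∈ S, s(u, v) ∈ ω) = Y} *
          (prodBernoulli w).real {ω : BondConfig (Fin n) |
            (∀ u ∈ Y, ¬ (openGraph (ω ∩ {e | ∀ v ∈ S, v ∉ e})).Reachable c u) ∧
              1 ≤ (A.filter fun z => ∃ u ∈ Y, (openGraph (ω ∩ {e | ∀ v ∈ S, v ∉ e})).Reachable u z).card ∧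
              (A.filter fun z => ∃ u ∈ Y, (openGraph (ω ∩ {e | ∀ v ∈ S, v ∉ e})).Reachable u z).card ≤ j} := by
  rw [measureReal_eq_sum_gateEq w S 𝒴 h𝒴]
  refine Finset.sum_congr rfl fun Y _ => ?_
  rw [setL_inter_gateEq A S Y c j hSA hc]
  exact measureReal_gateEq_inter_off w S Y (fun ξ =>
    (∀ u ∈ Y, ¬ (openGraph ξ).Reachable c u) ∧
      1 ≤ (A.filter fun z => ∃ u ∈ Y, (openGraph ξ).Reachable u z).card ∧
      (A.filter fun z => ∃ u ∈ Y, (openGraph ξ).Reachable u z).card ≤ j)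

/-- **Flat expansion, right event.**  `μ(c ↮ S, |π(c)| ≤ j) = Σ_{Y ∈ 𝒴} μ{Γ = Y} · μ(c ≁' Y, |π'(c)| ≤ j)`
whenever the gate set lies in `𝒴` a.s. (`c ∉ S`). [folklore] -/
theorem setR_eq_sum (w : Sym2 (Fin n) → unitInterval) (A S : Finset (Fin n)) (c : Fin n) (j : ℕ)
    (hc : c ∉ S) (𝒴 : Finset (Finset (Fin n)))
    (h𝒴 : (prodBernoulli w).real
      {ω : BondConfig (Fin n) | (Finset.univ.filter fun u => u ∉ S ∧ ∃ v ∈ S, s(u, v) ∈ ω) ∉ 𝒴} = 0) :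
    (prodBernoulli w).real {ω : BondConfig (Fin n) | (∀ x ∈ S, ω ∉ openConn c x) ∧
        (A.filter fun z => ω ∈ openConn c z).card ≤ j} =
      ∑ Y ∈ 𝒴,
        (prodBernoulli w).real
            {ω : BondConfig (Fin n) | (Finset.univ.filter fun u => u ∉ S ∧ ∃ v ∈ S, s(u, v) ∈ ω) = Y} *
          (prodBernoulli w).real {ω : BondConfig (Fin n) |
            (∀ u ∈ Y, ¬ (openGraph (ω ∩ {e | ∀ v ∈ S, v ∉ e})).Reachable c u) ∧
              (A.filter fun z => (openGraph (ω ∩ {e | ∀ v ∈ S, v ∉ e})).Reachable c z).card ≤ j} := by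
  rw [measureReal_eq_sum_gateEq w S 𝒴 h𝒴]
  refine Finset.sum_congr rfl fun Y _ => ?_
  rw [setR_inter_gateEq A S Y c j hc]
  exact measureReal_gateEq_inter_off w S Y (fun ξ =>
    (∀ u ∈ Y, ¬ (openGraph ξ).Reachable c u) ∧ (A.filter fun z => (openGraph ξ).Reachable c z).card ≤ j)

end SetStar

end CutObserver

end Summit.CriticalPhenomena.PercolationContinuityZ3.Theorems

end
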